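import Summits.ResolutionOfSingularities.ResolutionOfSingularities.Theorems.ValuativePatchingReductions
import Summits.ResolutionOfSingularities.ResolutionOfSingularities.Theorems.PatchingRel.Negative.HighDimSlice
import Literature.AlgebraicGeometry.Resolution.ProperModelsRegLeification

/-!
# Item `Patching` (stmt-ResolutionOfSingularities-0561): residual forms

Route `Valuative`, support item `Patching` = `∀ p prime, LU_p → ResolutionInChar.{0} p` (absolute,
weak local uniformization as antecedent). `ValuativePatchingReductions.lean` placed the item between
the summit and the crux `PatchingRel` and reduced it to two-model patching of proper models. This
file records the two RESIDUAL forms a planner or refuter needs, both kernel-checked: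

* `patching_iff_forall_lu_imp_localRegLeification` — modulo the named fact
  `NagataCompactification` (Conrad 2007, Thm. 4.1) the item is EQUIVALENT, prime by prime, to
  "`LU_p` ⇒ local RegLe-ification of one morphism of proper models"
  (`ProperModel.LocalRegLeification p`), the junction that both the strong atom `SAND⁺`
  (`SandwichedStrongResolution`, via gluing along the regular locus) and any weak sandwiched
  resolution statement feed; `patching_of_nagata_of_localRegLeification` is the unconditional
  direction. So the item closes the day the crux line `sandwiched-gluing` of stmt-0642 closes, with
  no input of its own.
* `lurel_of_twoModelPatching_of_lu` — two-model patching turns absolute `LU_p` into relative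
  `LUrel_p`, so the one conjunct by which the item exceeds the crux (weak ⇒ strong local
  uniformization, `patching_iff_patchingRel_and_weakToStrong`) is downstream of their common core.
* `patching_iff_highDim` — modulo the named fact `CossartPiltant2019` (Thm. 1.1, dimension `≤ 3`)
  the item is EQUIVALENT to its slice "absolute LU for function fields of transcendence degree
  `≥ 4` ⇒ resolution of varieties of dimension `≥ 4`": both ends are theorems up to dimension three
  (`lu_trdeg_le_three`, `resDimGe4_iff`), so the settled range gives no leverage on either side
  (Piltant 2013, p. 2: "All of these problems are open in dimension four or more").

## References

* O. Piltant, *An axiomatic version of Zariski's patching theorem*, RACSAM 107 (2013) 91–121,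
  p. 2 and proof of Prop. 5.1, Step 5. [Piltant2013]
* B. Conrad, *Deligne's notes on Nagata compactifications*, JRMS 22 (2007), Thm. 4.1. [Conrad2007]
* V. Cossart, O. Piltant, J. Algebra 529 (2019), Thm. 1.1. [CossartPiltant2019]
-/

noncomputable section

open CategoryTheory AlgebraicGeometry
open Literature.AlgebraicGeometry Literature.AlgebraicGeometry.Resolution
open Literature.AlgebraicGeometry.Morphisms

-- `Summit.<Summit>.<Sub>.Theorems` with `Sub = Summit` (single-conjunct summit, D-0017).
set_option linter.dupNamespace false

namespace Summit.ResolutionOfSingularities.ResolutionOfSingularities.Theorems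

open Summit.ResolutionOfSingularities.ResolutionOfSingularities.Theses

/-! ## Modulo Nagata: the item is `LU_p ⇒ LocalRegLeification_p` -/

/-- **Nagata compactification and local RegLe-ification in every prime characteristic imply the
item**: extend the local RegLe-ification to a proper model (`extension_of_nagata`,
`ProperModel.regLeification_of_local`), RegLe-ify twice on the join
(`SandwichedGluing.twoModelPatching_of_regLeification`) and run Zariski's resolving-system argument
on ABSOLUTE local uniformization (`patching_of_properTwoModelPatching`).
[cite: Piltant2013, proof of Prop. 5.1, Step 5] -/
theorem patching_of_nagata_of_localRegLeification (hN : NagataCompactification.{0})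
    (hL : ∀ p : ℕ, p.Prime → ProperModel.LocalRegLeification.{0} p) : Valuative.Patching :=
  patching_of_regLeification fun p hp =>
    ProperModel.regLeification_of_local p (SandwichedGluing.extension_of_nagata hN) (hL p hp)

/-- **Residual form of the item modulo Nagata**: `Patching ↔ ∀ p prime, LU_p →
LocalRegLeification_p`. (`→`: the item gives `ResolutionInChar p`, and a resolution of `M` is a
local RegLe-ification over `O = M`, `ProperModel.localRegLeification_of_resolutionInChar`; `←`:
`patching_of_nagata_of_localRegLeification` prime by prime.) The strong sandwiched atom `SAND⁺`
enters the crux line only through `LocalRegLeification`, so this is the exact junction the item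
shares with stmt-0642. [cite: Piltant2013, proof of Prop. 5.1, Steps 2-5] -/
theorem patching_iff_forall_lu_imp_localRegLeification (hN : NagataCompactification.{0}) :
    Valuative.Patching ↔
      ∀ p : ℕ, p.Prime → LocalUniformizationInChar.{0} p →
        ProperModel.LocalRegLeification.{0} p := by
  refine ⟨fun h p hp hLU => ProperModel.localRegLeification_of_resolutionInChar (h p hp hLU),
    fun h p hp hLU => ?_⟩
  exact resolutionInChar_of_properTwoModelPatching_of_lu
    (SandwichedGluing.twoModelPatching_of_regLeification p
      (ProperModel.regLeification_of_local p (SandwichedGluing.extension_of_nagata hN)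
        (h p hp hLU))) hLU

/-- Unconditionally, the item implies local RegLe-ification from absolute local uniformization in
every prime characteristic (no Nagata needed in this direction). [folklore] -/
theorem localRegLeification_of_patching_of_lu (h : Valuative.Patching) {p : ℕ} (hp : p.Prime)
    (hLU : LocalUniformizationInChar.{0} p) : ProperModel.LocalRegLeification.{0} p :=
  ProperModel.localRegLeification_of_resolutionInChar (h p hp hLU)

/-- **Two-model patching makes weak local uniformization strong**: under
`TwoModelPatching_p`, absolute `LU_p` implies relative `LUrel_p` (patch a uniformizing model with
a model carrying the prescribed `R`; formally: `Res_p ↔ TwoModelPatching_p ∧ LU_p` and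
`Res_p → LUrel_p`). So the one conjunct by which the item exceeds the crux `PatchingRel`
(`patching_iff_patchingRel_and_weakToStrong`) is downstream of their common core.
[cite: Piltant2013, Prop. 5.1 and Cor. 5.7] -/
theorem lurel_of_twoModelPatching_of_lu {p : ℕ} (hp : p.Prime)
    (hZ : ProperModel.TwoModelPatching.{0} p) (hLU : LocalUniformizationInChar.{0} p) :
    ∀ (k K : Type) [Field k] [CharP k p] [Field K] [Algebra k K],
      (⊤ : IntermediateField k K).FG → ∀ O : ValuationSubring K,
        (∀ c : k, algebraMap k K c ∈ O) → ∀ R : Subalgebra k K, R.FG →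
          R.toSubring ≤ O.toSubring →
            ∃ (A : Subalgebra k K) (h : A.toSubring ≤ O.toSubring), R ≤ A ∧ A.FG ∧
              IsFractionRing A K ∧ IsRegularLocalRing (Localization.AtPrime
                (Ideal.comap (Subring.inclusion h) (IsLocalRing.maximalIdeal O))) :=
  lurel_of_resolutionInChar p hp (resolutionInChar_of_properTwoModelPatching_of_lu hZ hLU)

/-! ## Modulo Cossart–Piltant 2019: the item is its dimension-`≥ 4` slice -/

/-- **Absolute local uniformization is free in transcendence degree `≤ 3`** (every ground field,
every characteristic), modulo `CossartPiltant2019`: the case `R = ⊥` of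
`PatchingRel.Negative.lurel_trdeg_le_three`. [cite: CossartPiltant2019, Thm. 1.1 with §4.1 (LU)] -/
theorem lu_trdeg_le_three (h : CossartPiltant2019.{0}) {k K : Type} [Field k] [Field K]
    [Algebra k K] (hKfg : (⊤ : IntermediateField k K).FG) (hK : Algebra.trdeg k K ≤ 3)
    (O : ValuationSubring K) (hO : ∀ c : k, algebraMap k K c ∈ O) :
    IsLocallyUniformizable k K O := by
  obtain ⟨A, hA, -, hAfg, hfr, hreg⟩ := PatchingRel.Negative.lurel_trdeg_le_three h hKfg hK O hO ⊥
    Subalgebra.fg_bot (fun x hx => by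
      obtain ⟨c, rfl⟩ := Algebra.mem_bot.mp hx
      exact hO c)
  exact ⟨A, hA, hAfg, hfr, hreg⟩

/-- Modulo `CossartPiltant2019`, absolute local uniformization in transcendence degree `≥ 4` is
equivalent to the full antecedent `LU_p` of the item. [folklore] -/
theorem luTrdegGe4_iff (h : CossartPiltant2019.{0}) (p : ℕ) :
    (∀ (k K : Type) [Field k] [CharP k p] [Field K] [Algebra k K], (⊤ : IntermediateField k K).FG →
        ¬ Algebra.trdeg k K ≤ 3 →
        ∀ O : ValuationSubring K, (∀ c : k, algebraMap k K c ∈ O) → IsLocallyUniformizable k K O) ↔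
      LocalUniformizationInChar.{0} p := by
  refine ⟨fun H k K _ _ _ _ hKfg O hO => ?_, fun H k K _ _ _ _ hKfg _ O hO => H k K hKfg O hO⟩
  by_cases hK : Algebra.trdeg k K ≤ 3
  · exact lu_trdeg_le_three h hKfg hK O hO
  · exact H k K hKfg hK O hO

/-- **The item `Patching` is its high-dimensional slice** (modulo `CossartPiltant2019`):
`Patching ↔ ∀ p prime, (LU_p in trdeg ≥ 4) → (Res_p in dim ≥ 4)`. A refutation needs absolute
local uniformization for the function fields of transcendence degree `≥ 4` in some characteristic
`p` together with a variety of dimension `≥ 4` without weak resolution; a proof gains nothing from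
the dimension-`≤ 3` theorems on either side. [cite: Piltant2013, p. 2] -/
theorem patching_iff_highDim (h : CossartPiltant2019.{0}) :
    Valuative.Patching ↔ ∀ p : ℕ, p.Prime →
      (∀ (k K : Type) [Field k] [CharP k p] [Field K] [Algebra k K], (⊤ : IntermediateField k K).FG →
        ¬ Algebra.trdeg k K ≤ 3 →
        ∀ O : ValuationSubring K, (∀ c : k, algebraMap k K c ∈ O) → IsLocallyUniformizable k K O) →
      (∀ (k : Type) [Field k] [CharP k p] (X : Scheme.{0}) (f : X ⟶ Spec (.of k)),
        IsSeparated f → LocallyOfFiniteType f → QuasiCompact f → IsReduced X →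
          ¬ topologicalKrullDim X ≤ 3 → Scheme.HasResolution X) :=
  ⟨fun H p hp hLU => (PatchingRel.Negative.resDimGe4_iff h p).mpr
      (H p hp ((luTrdegGe4_iff h p).mp hLU)),
    fun H p hp hLU => (PatchingRel.Negative.resDimGe4_iff h p).mp
      (H p hp ((luTrdegGe4_iff h p).mpr hLU))⟩

end Summit.ResolutionOfSingularities.ResolutionOfSingularities.Theorems

end
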